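import Summits.Langlands.Langlands.Theorems.RamifiedCoefficientSeedAdjointLiftingGL3BirthDefs
import Summits.Langlands.Langlands.Theorems.RamifiedCoefficientSeedAdjointLiftingGL3BirthDefs2
import Summits.Langlands.Langlands.Theorems.RamifiedCoefficientSeedAdjointLiftingGL3BirthDefs3
import Summits.Langlands.Langlands.Theorems.RamifiedCoefficientSeedAdjointLiftingGL3StubWeightTwoNewformLevel
import Summits.Langlands.Langlands.Theorems.RamifiedCoefficientSeedAdjointLiftingGL3StubWeightTwoNewformRep
import Summits.Langlands.Langlands.Theorems.RamifiedCoefficientSeedAdjointLiftingGL3StubWeightTwoNewformFor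
import Summits.Langlands.Langlands.Theorems.PhantomRMYoshidaSerreKWAutomorphicGL2ResidueAdaptedEmbedding
import Literature.NumberTheory.EllipticCurves.NewformGaloisRepIntegralityHolds
import Literature.NumberTheory.Automorphic.SerreConjectureProofs
import Literature.RingTheory.Valuation.AlgClosedResidue
import HarnessLib

/-!
# Crux `AdjointLiftingGL3` (stmt-Langlands-16779), line `birth`: stub S2c `stub_weightTwoNewform`
# — the weight-two newform for `ρ₀`, ALIGNED with `ι`

Registered stub of the checked skeleton `Cruxes/AdjointLiftingGL3/Lines/birth.lean` (v5), line lead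
prover-line-stmt-Langlands-16779-0.  For `p ≥ 11`, an odd `ρ₀ : Γ_ℚ → GL₂(ℚ̄_p)` with a residual
`τ₀` such that `ad⁰ τ₀` is absolutely irreducible, the local shape `LocalShapeAt p ρ₀ η` at `p`
(stub S2a) and Khare–Wintenberger (hypothesis, the tree's named fact `khare_wintenberger`), we
produce for every `ι : ℚ̄_p ≃ ℂ` and every algebraically closed discrete `k ⊇ ℤ̄_p/𝔪` (along `ιk`)
the datum `WeightTwoNewformAlong p ρ₀ ι k ιk`: a newform `g ∈ S₂(Γ₁(M))`, `p ∤ M`, with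
`σ̄ = ω̄^t ⊗ τ₀` attached along `ι_g(x) = ιk(ι⁻¹(x) mod 𝔪)` away from `M p`.

Assembly (all ingredients are theorems of the tree, landed as the three helper files of this stub,
except KW which is a hypothesis):

1. `σ̄ = ω̄^t ⊗ (ιk ∘ τ₀)` over `k`, continuous, odd, irreducible (`exists_twistRep`, helper 2), with
   `t = (p − 2) s` for the exponent `s` of the local shape, so that `ω̄^s ω̄^t = 1`;
2. at the place `v ∋ p` (helpers of stub S2b: `exists_heightOneSpectrum_natCast_mem`,
   `residueFieldCard_adicCompletion_eq_of_mem`, `irreducible_natCast_valuativeInteger_of_mem`,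
   `exists_isReductionOf_rank_one`; `nonempty_ringHom_residue`) the local shape gives Serre weight
   `k(σ̄) = 2` (`exists_serreWeight_eq_two`, helper 3; Serre 1987, §2.8 Prop. 3);
3. Khare–Wintenberger at `(k, σ̄, loc, ιk ∘ ιr)`: a newform `f ∈ S₂(Γ₁(N(σ̄)))`, `p ∤ N(σ̄)`
   (`not_dvd_serreLevel`), and `ι_f : 𝓞_f → k` with `σ̄` attached — `WeightTwoNewformFor`;
4. ALIGNMENT (`weightTwoNewformAlong_of_for`): a residue-adapted embedding `τ : K_f → ℂ`,
   `θ = ι⁻¹ τ` on `𝓞_f`, `red ∘ θ = ι_f` for `red = ιk ∘ (mod 𝔪)` (`stub_residueAdaptedEmbedding`,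
   crux `SerreKWAutomorphicGL2`); the conjugate newform `g = f^τ` OF THE SAME LEVEL
   (`conjugateNewform_sameLevel`, helper 1; Diamond–Shurman Thm. 6.5.4 with multiplicity one across
   levels); `ι_g = red ∘ ι⁻¹|𝓞_g` (algebraic integers are `p`-integral,
   `mem_valuedInteger_of_isIntegral`); and at `q ∤ N p` the integral Hecke polynomial `P_g` of `g`
   (`IsNewform1.exists_map_eq_heckePolynomial_holds`) satisfies
   `ι_g(P_g) = red(ι⁻¹ H_q(g)) = red(ι⁻¹ τ H_q(f)) = red(θ P_f) = ι_f(P_f) = charpoly σ̄(Frob_q)`.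
-/

set_option linter.dupNamespace false -- `Summit.Langlands.Langlands` is the mandated namespace

noncomputable section

namespace Summit.Langlands.Langlands.Cruxes.AdjointLiftingGL3.Birth

open scoped MatrixGroups NumberField Polynomial
open NumberField IsDedekindDomain Field Filter ValuativeRel Polynomial CongruenceSubgroup
open Literature.NumberTheory.GaloisRepresentations Literature.NumberTheory.PAdicHodge
open Literature.NumberTheory.Automorphic
open Literature.NumberTheory.EllipticCurves.ModularForms
open Literature.NumberTheory.GaloisRepresentations.IsNonarchimedeanLocalField
open Literature.NumberTheory.GaloisRepresentations.ModPGaloisRep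
open Summit.Langlands.Langlands.Cruxes.SerreKWAutomorphicGL2.AdelicNewformDatumDoubleTwist

/-! ## Alignment: `WeightTwoNewformFor` ⇒ `WeightTwoNewformAlong` -/

/-- **Alignment of the coefficient map with `ι`.**  Over an algebraically closed `k` of
characteristic `p`, a weight-two newform datum for `ρ₀` (`WeightTwoNewformFor p ρ₀ k ιk`: `f`,
`ι_f : 𝓞_f → k`, `σ̄`) can be replaced, for every `ι : ℚ̄_p ≃ ℂ`, by an ALIGNED one
(`WeightTwoNewformAlong p ρ₀ ι k ιk`): take a residue-adapted embedding `τ : K_f → ℂ` with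
`θ = ι⁻¹ ∘ τ : 𝓞_f → ℤ̄_p` and `ιk ∘ (mod 𝔪) ∘ θ = ι_f` (`stub_residueAdaptedEmbedding`), the
Galois-conjugate newform `g = f^τ` of the same level (`conjugateNewform_sameLevel`), and
`ι_g = ιk ∘ (mod 𝔪) ∘ ι⁻¹` on `𝓞_g` (`p`-integral: `mem_valuedInteger_of_isIntegral`); at `q ∤ N p`
the integral Hecke polynomials (`exists_map_eq_heckePolynomial_holds`) then satisfy
`ι_g(P_g) = ι_f(P_f)` in `k[X]`, because both lift to `ℤ̄_p[X]` with the same image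
`ι⁻¹(τ H_q(f)) = ι⁻¹(H_q(g))` in `ℚ̄_p[X]`. [cite: DiamondShurman2005, Thm. 6.5.4]
[cite: KhareWintenberger2009, Thm. 1.2] -/
theorem weightTwoNewformAlong_of_for {p : ℕ} [Fact p.Prime] {ρ₀ : FramedGaloisRep ℚ (PadicAlgCl p) 2}
    {k : Type} [Field k] [CharP k p] [IsAlgClosed k] [TopologicalSpace k]
    {ιk : padicAlgClResidueField p →+* k} (h : WeightTwoNewformFor p ρ₀ k ιk)
    (ι : PadicAlgCl p ≃+* ℂ) : WeightTwoNewformAlong p ρ₀ ι k ιk := by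
  classical
  obtain ⟨N, instN, f, ιf, s, τ₀, σb, hpN, hf, hgal, hτ₀, hσ⟩ := h
  -- the residue-adapted embedding and the conjugate newform of the same level
  let red : Valued.integer (PadicAlgCl p) →+* k :=
    ιk.comp (IsLocalRing.residue (padicAlgClIntegers p))
  have hred_apply : ∀ y : Valued.integer (PadicAlgCl p),
      red y = ιk (IsLocalRing.residue (padicAlgClIntegers p) y) := fun _ => rfl
  obtain ⟨τ, θ, hθ, hred⟩ := stub_residueAdaptedEmbedding p k red ι N 2 f hf ιf
  obtain ⟨g, hg, hconj⟩ := conjugateNewform_sameLevel N 2 f hf τ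
  -- `ι_g = red ∘ ι⁻¹` on `𝓞_g`
  let φ : coeffCharField g →+* PadicAlgCl p :=
    (ι.symm : ℂ →+* PadicAlgCl p).comp (algebraMap (coeffCharField g) ℂ)
  have hφ : ∀ x : coeffCharField g, φ x = ι.symm (x : ℂ) := fun _ => rfl
  have hmem : ∀ x : coeffCharIntegers g,
      ι.symm ((x : coeffCharField g) : ℂ) ∈ padicAlgClIntegers p := fun x => by
    have hx : IsIntegral ℤ (x : coeffCharField g) := x.2
    exact mem_valuedInteger_of_isIntegral (hx.map φ.toIntAlgHom)
  let θg : coeffCharIntegers g →+* Valued.integer (PadicAlgCl p) :=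
    (φ.comp (algebraMap (coeffCharIntegers g) (coeffCharField g))).codRestrict
      (Valued.integer (PadicAlgCl p)) fun x => hmem x
  have hθg : ∀ x : coeffCharIntegers g,
      ((θg x : Valued.integer (PadicAlgCl p)) : PadicAlgCl p) = ι.symm ((x : coeffCharField g) : ℂ) :=
    fun _ => rfl
  let ιg : coeffCharIntegers g →+* k := red.comp θg
  refine ⟨N, instN, g, ιg, s, τ₀, σb, hpN, hg, ?_, hτ₀, hσ, fun x => ⟨hmem x, rfl⟩⟩
  -- `σ̄` is attached to `g` along `ι_g` away from `N p`
  intro v hv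
  obtain ⟨hunr, Pf, hPf, hFrob⟩ := hgal v hv
  have hq : ((Rat.HeightOneSpectrum.primesEquiv v : Nat.Primes) : ℕ).Prime :=
    (Rat.HeightOneSpectrum.primesEquiv v).2
  have hqN : ¬ ((Rat.HeightOneSpectrum.primesEquiv v : Nat.Primes) : ℕ) ∣ N := fun h' =>
    hv (dvd_mul_of_dvd_left h' p)
  obtain ⟨Pg, hPg⟩ := IsNewform1.exists_map_eq_heckePolynomial_holds hg (by norm_num)
    ((Rat.HeightOneSpectrum.primesEquiv v : Nat.Primes) : ℕ)
  refine ⟨hunr, Pg, hPg, ?_⟩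
  -- `ι_g(P_g) = ι_f(P_f)`: compare the lifts to `ℤ̄_p[X]` inside `ℚ̄_p[X]`
  have hθ' : (Valued.integer (PadicAlgCl p)).subtype.comp θ =
      ((ι.symm : ℂ →+* PadicAlgCl p).comp τ).comp
        (algebraMap (coeffCharIntegers f) (coeffCharField f)) :=
    RingHom.ext fun x => hθ x
  have hθg' : (Valued.integer (PadicAlgCl p)).subtype.comp θg =
      φ.comp (algebraMap (coeffCharIntegers g) (coeffCharField g)) :=
    RingHom.ext fun x => hθg x
  have h1 : (Pg.map θg).map (Valued.integer (PadicAlgCl p)).subtype =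
      (Pf.map θ).map (Valued.integer (PadicAlgCl p)).subtype := by
    rw [Polynomial.map_map, Polynomial.map_map, hθ', hθg', ← Polynomial.map_map, hPg,
      ← Polynomial.map_map, ← Polynomial.map_map, hPf, ← Polynomial.map_map, ← hconj _ hq hqN]
  have h2 : Pg.map θg = Pf.map θ :=
    Polynomial.map_injective _ Subtype.val_injective h1
  have h3 : Pg.map ιg = Pf.map ιf := by
    have h := congrArg (Polynomial.map red) h2
    rw [Polynomial.map_map, Polynomial.map_map] at h
    have hredθ : red.comp θ = ιf := RingHom.ext hred
    rw [hredθ] at h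
    exact h
  rw [h3]
  exact hFrob


/-! ## The stub -/

/-- **S2c — the weight-two newform for `ρ₀`, ALIGNED WITH `ι`** (registered stub
`stub_weightTwoNewform` of the birth skeleton v5).  Let `p ≥ 11`, `ρ₀ : Γ_ℚ → GL₂(ℚ̄_p)` odd with a
residual `τ₀` such that `ad⁰ τ₀` is absolutely irreducible, `LocalShapeAt p ρ₀ η`, and assume
Khare–Wintenberger for every discrete `k`.  Then for every `ι : ℚ̄_p ≃ ℂ` and every algebraically
closed discrete `k` of characteristic `p` with `ιk : ℤ̄_p/𝔪 → k`, `WeightTwoNewformAlong p ρ₀ ι k ιk`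
holds: there are `M` with `p ∤ M`, a newform `g ∈ S₂(Γ₁(M))`, `ι_g(x) = ιk(ι⁻¹(x) mod 𝔪)` on `𝓞_g`,
an exponent `t` and the continuous odd irreducible `σ̄ = ω̄^t ⊗ (ιk ∘ τ₀)` attached to `g` along
`ι_g` away from `M p`.  Proof: `t = (p − 2) s` for the exponent `s` of the local shape at the
place `v ∋ p`; `σ̄` by `exists_twistRep`; Serre weight `k(σ̄) = 2` at the datum `(ℚ_v, σ̄|Γ_{ℚ_v})`
by `exists_serreWeight_eq_two` (Serre 1987, §2.8 Prop. 3); Khare–Wintenberger gives a newform of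
level `N(σ̄)` prime to `p` (`not_dvd_serreLevel`) and weight `2` with `σ̄` attached
(`WeightTwoNewformFor`); alignment by `weightTwoNewformAlong_of_for`.
[cite: KhareWintenberger2009, Thm. 1.2] [cite: Serre1987, §2.8 Prop. 3 and (3.2.4)] -/
theorem stub_weightTwoNewform :
    ∀ (p : ℕ) [Fact p.Prime], 11 ≤ p →
      ∀ (ρ₀ : FramedGaloisRep ℚ (PadicAlgCl p) 2) (η : FramedGaloisRep ℚ (PadicAlgCl p) 1),
        ρ₀.IsOdd →
        (∃ τ₀ : absoluteGaloisGroup ℚ →* GL (Fin 2) (padicAlgClResidueField p),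
            ρ₀.IsResidualRepOf (RingHom.id _) τ₀ ∧ IsAbsIrreducible (adZeroOf τ₀)) →
        LocalShapeAt p ρ₀ η →
        (∀ (k : Type) [Field k] [TopologicalSpace k] [DiscreteTopology k], khare_wintenberger p k) →
        ∀ (ι : PadicAlgCl p ≃+* ℂ) (k : Type) [Field k] [CharP k p] [IsAlgClosed k]
          [TopologicalSpace k] [DiscreteTopology k] (ιk : padicAlgClResidueField p →+* k),
          WeightTwoNewformAlong p ρ₀ ι k ιk := by
  intro p _ hp ρ₀ η hodd hex hshape hKW ι k _ _ _ _ _ ιk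
  classical
  have hpp : p.Prime := Fact.out
  obtain ⟨τ₀, hτ₀, hirr⟩ := hex
  haveI := charP_padicAlgClResidueField p
  haveI : IsAlgClosed (padicAlgClResidueField p) :=
    Literature.RingTheory.Valuation.isAlgClosed_residueField (padicAlgClIntegers p)
  -- the place `v ∋ p`, residue embedding, reduction of `η`, and the local shape
  obtain ⟨v, hv⟩ := exists_heightOneSpectrum_natCast_mem p
  have hq : residueFieldCard (v.adicCompletion ℚ) = p := residueFieldCard_adicCompletion_eq_of_mem hpp hv
  have hϖ : Irreducible ((p : ℕ) : 𝒪[v.adicCompletion ℚ]) :=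
    irreducible_natCast_valuativeInteger_of_mem hpp hv
  obtain ⟨ιr⟩ := nonempty_ringHom_residue (k := padicAlgClResidueField p) p (v.adicCompletion ℚ) hq
  obtain ⟨ηb, _, hηb, -, -⟩ := exists_isReductionOf_rank_one p η
  obtain ⟨-, s, hT⟩ := hshape v hv τ₀ ηb hτ₀ hηb ιr _ hϖ
  -- the exponent `t = (p - 2) s`: `ω̄^s ω̄^t = 1`
  have hst : ∀ u : (ZMod p)ˣ, u ^ s * u ^ ((p - 2) * s) = 1 := fun u => by
    have h1 : p - 1 = (p - 2) + 1 := by omega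
    rw [← pow_add, show s + (p - 2) * s = (p - 1) * s by rw [h1, add_mul, one_mul, add_comm],
      mul_comm, pow_mul, ZMod.units_pow_card_sub_one_eq_one]
  -- the twist `σ̄ = ω̄^t ⊗ (ιk ∘ τ₀)` and its Serre weight
  obtain ⟨σb, hoddσ, hirrσ, hσb⟩ := exists_twistRep p k ιk ((p - 2) * s) ρ₀ τ₀ hodd hτ₀ hirr
  obtain ⟨loc, ι', hw⟩ :=
    exists_serreWeight_eq_two p (by omega) k ιk s ((p - 2) * s) hst τ₀ σb hσb v hv ιr hϖ hT
  -- Khare–Wintenberger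
  have hKW' := hKW k σb hirrσ hoddσ loc ι'
  rw [hw, Nat.cast_ofNat] at hKW'
  obtain ⟨f, ιf, hf, hgal⟩ := hKW'
  have hfor : WeightTwoNewformFor p ρ₀ k ιk :=
    ⟨serreLevel p σb, ⟨fun h => not_dvd_serreLevel p σb (h ▸ dvd_zero p)⟩, f, ιf, (p - 2) * s, τ₀, σb,
      not_dvd_serreLevel p σb, hf, hgal, hτ₀, hσb⟩
  exact weightTwoNewformAlong_of_for hfor ι

end Summit.Langlands.Langlands.Cruxes.AdjointLiftingGL3.Birth

end
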